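import Summits.ABC.IUTFork.Cor312VolumesSummandsBridge
import HarnessLib

/-!
# [IUTchIII] Corollary 3.12 — the verbatim container: (Ind1)/(Ind2) are VOLUME-IDLE, so READING 1 is a
# statement about the Θ-region alone

Record-only file (D-0012) of the abc-iut cell (Cor. 3.12 sub-crew support; seat abc-iut-w5-d135, an RQ7
second-reader's census corollary of abc-iut-c312-5's `Cor312VolumesSummandsBridge` (p412060) and
abc-iut-c312-6's `Cor312StatementBridge` (p406562)); PROOF-ONLY (no definition, no named fact); TAKES NO SIDE.

S. Mochizuki, *Inter-universal Teichmüller theory III*, kurims manuscript, proof of Cor. 3.12, Step (x),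
p. 181 l. 5–13: "the procession-normalized mono-analytic log-volumes … are invariant with respect to the
indeterminacies (Ind1), (Ind2)".  For a `Cor312.Setting P` (abc-iut-c312-7) whose line `S.D P.n` REALIZES the
verbatim summand container `V : SummandPieces S.L` ([IUTchIII] Rmk. 3.1.1 (ii)(iii)) with `GeneratorsPreserve`
(PROVED for the real prime packets, `Cor312VolumesPadicSummands`) and an admissible (Ind3)-enlarged Θ-region,
c312-5 proved that every possible image of the Θ-pilot object — every `indGroup`-translate of `thetaRegion3` — has
the SAME packet log-volume as `thetaRegion3`.  This file records the two global consequences: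

* `assemble_logvol_imageChoice_eq_theta` — EVERY global choice of possible images (c312-6's `ImageChoice`) has
  the same assembled, procession-normalised log-volume as the box of the Θ-regions themselves: the
  indeterminacies (Ind1), (Ind2) move regions but change NO log-volume;
* `reading1_iff_thetaBox` — hence c312-6's READING 1 of Step (xi) (`statement_of_represented`: "some global
  choice of possible images has assembled log-volume `−|log(q)|`", LANA §8.3 / (9-1) at volume level) is
  EQUIVALENT to the single equation "assembled log-volume of the Θ-region box `= −|log(q)|`" — no
  existential content is left to the (Ind1)/(Ind2)-orbit.

Census value only (for the cell's (G) sentence: at the verbatim container a volume-level reading gets no help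
from (Ind1)/(Ind2); whatever relates the Θ-pilot volume to the `q`-pilot volume lives at the hull /
region-inclusion level, Readings 2/3).  Nothing is asserted about Cor. 3.12.
[claim: Mochizuki2012, status: disputed] for the quoted sentence; the theorems are [folklore] bookkeeping.
-/

noncomputable section

open Set Function

namespace Summit.ABC

namespace IUTFork

namespace Cor312Vol

namespace SummandPieces

open Thm311 Cor312 Literature.IUT.LogThetaLattice

variable {T : ThetaIndex} {S : Situation T} {V : SummandPieces S.L} {P : Cor312.Setting S}

/-- **(Ind1)/(Ind2) are volume-idle on global choices**: if the line realizes the verbatim summand container,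
the (Ind1)/(Ind2) generators preserve it, and the (Ind3)-enlarged Θ-region is admissible at the labels
`j ∈ 𝔽_l^⋇`, then EVERY global choice `U` of possible images has the same assembled (procession-normalised)
log-volume as the box of the Θ-regions (Step (x), p. 181 l. 5–13, for the verbatim container).
[cite: Mochizuki2012, IUTchIII Cor. 3.12 proof Step (x) p.181] -/
theorem assemble_logvol_imageChoice_eq_theta (hD : V.Realizes (S.D P.n)) (hG : V.GeneratorsPreserve)
    (hθ : ∀ (i : Fin T.lstar) (vQ : T.VQ), (S.D P.n).Adm _ vQ (P.thetaRegion3 (Setting.labelSucc i) vQ))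
    (hmono : LogvolMono P) (U : ImageChoice P) :
    (toLocalFamily P hmono).assemble.logvol (Set.univ.pi U.1) =
      (toLocalFamily P hmono).assemble.logvol
        (Set.univ.pi fun t : Fin T.lstar × T.VQ => P.thetaRegion3 (Setting.labelSucc t.1) t.2) := by
  have hθne : ∀ t : Fin T.lstar × T.VQ, (P.thetaRegion3 (Setting.labelSucc t.1) t.2).Nonempty := fun t =>
    SummandPieces.Adm.nonempty ((hD.adm_iff _ t.2 _).1 (hθ t.1 t.2))
  have hne : ∀ t : Fin T.lstar × T.VQ, (U.1 t).Nonempty := fun t =>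
    SummandPieces.Adm.nonempty ((hD.adm_iff _ t.2 _).1
      (SummandPieces.adm_and_logvol_possibleImage_eq hD hG (hθ t.1 t.2) (U.2 t)).1)
  rw [LocalFamily.assemble_logvol_pi _ _ hne, LocalFamily.assemble_logvol_pi _ _ hθne]
  refine finsum_congr fun t => ?_
  congr 1
  exact (SummandPieces.adm_and_logvol_possibleImage_eq hD hG (hθ t.1 t.2) (U.2 t)).2

/-- **READING 1 is a statement about the Θ-region alone**: under the same hypotheses, c312-6's Reading 1
("`∃` global choice of possible images with assembled log-volume `−|log(q)|`", the hypothesis of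
`statement_of_represented`) holds iff the Θ-region box itself has assembled log-volume `−|log(q)|`.
[cite: Mochizuki2012, IUTchIII Cor. 3.12 proof Step (x) p.181] -/
theorem reading1_iff_thetaBox (hD : V.Realizes (S.D P.n)) (hG : V.GeneratorsPreserve)
    (hθ : ∀ (i : Fin T.lstar) (vQ : T.VQ), (S.D P.n).Adm _ vQ (P.thetaRegion3 (Setting.labelSucc i) vQ))
    (hmono : LogvolMono P) :
    (∃ U : ImageChoice P, (toLocalFamily P hmono).assemble.logvol (Set.univ.pi U.1) = P.negLogQ) ↔
      (toLocalFamily P hmono).assemble.logvol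
        (Set.univ.pi fun t : Fin T.lstar × T.VQ => P.thetaRegion3 (Setting.labelSucc t.1) t.2) = P.negLogQ := by
  constructor
  · rintro ⟨U, hU⟩
    rwa [assemble_logvol_imageChoice_eq_theta hD hG hθ hmono U] at hU
  · intro h
    exact ⟨⟨fun t => P.thetaRegion3 _ t.2, fun t => P.thetaRegion3_mem_possibleImages _ t.2⟩, h⟩

/-- Consequently the printed Statement follows, at such a setting, from the SINGLE volume equation for the
Θ-region box together with c312-6's `BridgeHyps` (Reading 1 route `statement_of_represented`) — a form in which
(Ind1)/(Ind2) no longer appear. Hypothesis, not asserted. [cite: Mochizuki2012, IUTchIII Cor. 3.12 p.173] -/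
theorem statement_of_thetaBox_logvol_eq (hD : V.Realizes (S.D P.n)) (hG : V.GeneratorsPreserve)
    (hθ : ∀ (i : Fin T.lstar) (vQ : T.VQ), (S.D P.n).Adm _ vQ (P.thetaRegion3 (Setting.labelSucc i) vQ))
    (H : BridgeHyps P)
    (h : (toLocalFamily P H.mono).assemble.logvol
        (Set.univ.pi fun t : Fin T.lstar × T.VQ => P.thetaRegion3 (Setting.labelSucc t.1) t.2) = P.negLogQ) :
    P.Statement :=
  statement_of_represented H ((reading1_iff_thetaBox hD hG hθ H.mono).2 h)

end SummandPieces

end Cor312Vol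

end IUTFork

end Summit.ABC

end
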